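import Summits.RiemannHypothesis.RiemannHypothesis.Theses.RuelleBand
import Literature.Barriers.RiemannHypothesis.BohrDenseValuesProofs
import Literature.Barriers.RiemannHypothesis.BohrDenseValuesVoronin
import HarnessLib

/-!
# `ZetaWeakRecurrence` (crux stmt-RiemannHypothesis-18110, route RuelleBand) — load-bearing analysis, I

Negative-side support file of the crux disprover (cdisprove seat, cycle 1). WR, the crux:
`∀ z r, 0 < r → r < min (Re z − 1/2) (1 − Re z) → ∀ ε > 0, ∀ T, ∃ τ ≥ T, ∀ s ∈ closedBall z r,
‖ζ(s + iτ) − ζ(s)‖ < ε`. Which hypotheses carry weight: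

* `zeta_pointwise_recurrence` — POINTWISE recurrence (`r = 0`) is a THEOREM at every point of the open strip,
  zeros included (Voronin/Bohr denseness of the tail of every line, tree `exists_mem_of_isOpen`). So the open
  content of WR is UNIFORMITY on a disc about a hypothetical off-line zero, not recurrence of values.
* `zetaWeakRecurrence_iff_without_pos` — dropping `0 < r` gives an EQUIVALENT statement (`r < 0`: empty disc;
  `r = 0`: pointwise recurrence): `0 < r` is decoration.
* `zetaWeakRecurrence_false_without_rightEdge` — dropping the right edge `r < 1 − Re z` gives a FALSE statement,
  for a degenerate reason: a disc containing the pole `s = 1` never recurs (`ζ` is unbounded near `1`, Mathlib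
  `isBigO_riemannZeta_sub_one_div`, while every shifted copy `ζ(· + iτ)`, `τ ≥ 1`, is bounded on the disc).
The left edge (growth left of the line) is in `LeftEdgeGrowth.lean`; the lateness clause in `Rigidity.lean`.
-/


noncomputable section

open Complex Set Metric Filter Topology

namespace Summit.RiemannHypothesis.RiemannHypothesis.Theorems.ZetaWeakRecurrence.Negative

open Summit.RiemannHypothesis.RiemannHypothesis.Theses.RuelleBand
open Literature.Barriers.RiemannHypothesis

/-- POINTWISE recurrence of `ζ` under vertical shifts is a THEOREM at every point `z` of the open strip
`1/2 < Re z < 1` — including at a hypothetical off-line zero: the values `ζ(Re z + it)`, `t ≥ T₀`, are dense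
in `ℂ` (tree `exists_mem_of_isOpen` from Voronin's theorem, proved). [cite: Steuding2007, Thm. 1.7] -/
theorem zeta_pointwise_recurrence {z : ℂ} (hz : 1 / 2 < z.re) (hz' : z.re < 1) {ε : ℝ} (hε : 0 < ε)
    (T : ℝ) : ∃ τ : ℝ, T ≤ τ ∧ ‖riemannZeta (z + τ * I) - riemannZeta z‖ < ε := by
  obtain ⟨t, ht, hmem⟩ := exists_mem_of_isOpen Voronin1975_universality_holds hz hz'
    Metric.isOpen_ball ⟨riemannZeta z, Metric.mem_ball_self hε⟩ (T + z.im)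
  refine ⟨t - z.im, by linarith, ?_⟩
  have : z + ((t - z.im : ℝ) : ℂ) * I = (z.re : ℂ) + (t : ℂ) * I := by
    apply Complex.ext <;> simp
  rw [this, ← dist_eq_norm]
  exact hmem

/-- `0 < r` is NOT load-bearing: WR is EQUIVALENT to the same statement with `0 < r` dropped (`r < 0` is
the empty disc, `r = 0` is pointwise recurrence, a theorem). [folklore] -/
theorem zetaWeakRecurrence_iff_without_pos :
    ZetaWeakRecurrence ↔ ∀ (z : ℂ) (r : ℝ), r < min (z.re - 1 / 2) (1 - z.re) → ∀ ε : ℝ, 0 < ε →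
      ∀ T : ℝ, ∃ τ : ℝ, T ≤ τ ∧
        ∀ s ∈ Metric.closedBall z r, ‖riemannZeta (s + ↑τ * Complex.I) - riemannZeta s‖ < ε := by
  refine ⟨fun h z r hr ε hε T => ?_, fun h z r _ hr => h z r hr⟩
  rcases lt_trichotomy r 0 with hneg | rfl | hpos
  · refine ⟨T, le_rfl, fun s hs => ?_⟩
    rw [Metric.closedBall_eq_empty.2 hneg] at hs
    exact absurd hs (Set.notMem_empty s)
  · have hz : 1 / 2 < z.re := by have := hr.trans_le (min_le_left _ _); linarith
    have hz' : z.re < 1 := by have := hr.trans_le (min_le_right _ _); linarith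
    obtain ⟨τ, hτ, hlt⟩ := zeta_pointwise_recurrence hz hz' hε T
    refine ⟨τ, hτ, fun s hs => ?_⟩
    rw [Metric.closedBall_zero, Set.mem_singleton_iff] at hs
    subst hs
    exact hlt
  · exact h z r hpos hr ε hε T

/-- Dropping the RIGHT-EDGE hypothesis `r < 1 − Re z` (discs anywhere in `Re s > 1/2 + r`) gives a FALSE
statement, for a DEGENERATE reason: a disc containing the pole `s = 1` never recurs — `ζ(s) − 1/(s−1)` is
bounded near `1` (Mathlib `isBigO_riemannZeta_sub_one_div`) so `ζ` is unbounded there, while each shifted copy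
`ζ(· + iτ)`, `τ ≥ 1`, is continuous hence bounded on the disc. Witness `z = 1`, `r = 1/4`, `ε = 1`, `T = 1`.
(Discs of `{Re s > 1/2}` avoiding the pole but crossing `Re s = 1` are expected to recur; not claimed.)
[folklore] -/
theorem zetaWeakRecurrence_false_without_rightEdge :
    ¬ ∀ (z : ℂ) (r : ℝ), 0 < r → r < z.re - 1 / 2 → ∀ ε : ℝ, 0 < ε → ∀ T : ℝ, ∃ τ : ℝ, T ≤ τ ∧
      ∀ s ∈ Metric.closedBall z r, ‖riemannZeta (s + ↑τ * Complex.I) - riemannZeta s‖ < ε := by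
  intro h
  obtain ⟨τ, hτ, hret⟩ := h 1 (1 / 4) (by norm_num) (by norm_num) 1 one_pos 1
  -- the shifted copy is bounded on the disc
  have hcont : ContinuousOn (fun s : ℂ => riemannZeta (s + τ * I)) (closedBall (1 : ℂ) (1 / 4)) := by
    intro s hs
    have hs1 : s + τ * I ≠ 1 := by
      intro h1
      have him := congrArg Complex.im h1
      simp only [add_im, mul_im, ofReal_re, I_im, mul_one, ofReal_im, I_re, mul_zero, add_zero,
        one_im] at him
      rw [mem_closedBall, dist_eq_norm] at hs
      have h2 := (abs_im_le_norm (s - 1)).trans hs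
      rw [sub_im, one_im, sub_zero, abs_le] at h2
      linarith [h2.1]
    exact ((differentiableAt_riemannZeta hs1).comp s
      (differentiableAt_id.add_const _)).continuousAt.continuousWithinAt
  obtain ⟨M, hM⟩ := (isCompact_closedBall (1 : ℂ) (1 / 4)).exists_bound_of_continuousOn hcont
  -- `ζ s - 1/(s-1)` is bounded near `1`
  obtain ⟨c, hc⟩ := (isBigO_riemannZeta_sub_one_div (F := ℝ)).bound
  rw [Metric.eventually_nhds_iff] at hc
  obtain ⟨ρ, hρ, hc⟩ := hc
  -- a real point `1 + δ` close to the pole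
  set K : ℝ := |M| + |c| + 2 with hK
  have hKpos : 0 < K := by positivity
  set δ : ℝ := min (ρ / 2) (min (1 / 4) (1 / K)) with hδ
  have hδpos : 0 < δ := lt_min (by linarith) (lt_min (by norm_num) (by positivity))
  have hδρ : δ < ρ := (min_le_left _ _).trans_lt (by linarith)
  have hδ4 : δ ≤ 1 / 4 := (min_le_right _ _).trans (min_le_left _ _)
  have hδK : δ ≤ 1 / K := (min_le_right _ _).trans (min_le_right _ _)
  set s : ℂ := 1 + (δ : ℂ) with hsdef
  have hs1 : s - 1 = (δ : ℂ) := by rw [hsdef]; ring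
  have hnormδ : ‖(δ : ℂ)‖ = δ := by rw [norm_real, Real.norm_eq_abs, abs_of_pos hδpos]
  have hsball : s ∈ closedBall (1 : ℂ) (1 / 4) := by
    rw [mem_closedBall, dist_eq_norm, hs1, hnormδ]; exact hδ4
  have hsdist : dist s 1 < ρ := by rw [dist_eq_norm, hs1, hnormδ]; exact hδρ
  have hbig : K ≤ ‖1 / (s - 1)‖ := by
    rw [hs1, norm_div, norm_one, hnormδ]
    rw [le_div_iff₀ hδpos]
    calc K * δ ≤ K * (1 / K) := by gcongr
      _ = 1 := by field_simp
  have hnear : ‖riemannZeta s - 1 / (s - 1)‖ ≤ c * ‖(1 : ℝ)‖ := hc hsdist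
  rw [norm_one, mul_one] at hnear
  have hζs : |M| + 2 ≤ ‖riemannZeta s‖ := by
    have h1 : ‖1 / (s - 1)‖ ≤ ‖riemannZeta s‖ + ‖riemannZeta s - 1 / (s - 1)‖ := by
      calc ‖1 / (s - 1)‖ = ‖riemannZeta s - (riemannZeta s - 1 / (s - 1))‖ := by ring_nf
        _ ≤ ‖riemannZeta s‖ + ‖riemannZeta s - 1 / (s - 1)‖ := norm_sub_le _ _
    have h2 : c ≤ |c| := le_abs_self c
    linarith
  have hshift : ‖riemannZeta (s + τ * I)‖ ≤ |M| := (hM s hsball).trans (le_abs_self M)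
  have hlt := hret s hsball
  have hge : ‖riemannZeta s‖ - ‖riemannZeta (s + τ * I)‖ ≤
      ‖riemannZeta (s + τ * I) - riemannZeta s‖ := by
    have := norm_sub_norm_le (riemannZeta s) (riemannZeta (s + τ * I))
    rwa [norm_sub_rev] at this
  linarith

end Summit.RiemannHypothesis.RiemannHypothesis.Theorems.ZetaWeakRecurrence.Negative

end
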